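import Summits.QuantumFields.YangMills.Theorems.ColdStartUniversalityLatticeLangevinWilsonGeneratorPoincare
import Summits.QuantumFields.YangMills.Theorems.ColdStartUniversalityUniformColdStartMixingOfChiSquare
import Summits.QuantumFields.YangMills.Theorems.ColdStartUniversalityLatticeLangevinWilsonGeneratorPoincareOfDecay
import Summits.QuantumFields.YangMills.Theorems.ColdStartUniversalityUniformColdStartMixingL2GapTFAE
import HarnessLib

/-!
# Route `ColdStartUniversality`, crux K_A1 `UniformColdStartMixing` (stmt-QuantumFields-24809, aside; implies `NeutralColdStartMixing`
# 27363 a fortiori), `L²` twin of LINE 4 «cold_entropy»: THE CRUX FROM A K-UNIFORM STATIC (GENERATOR-FORM) POINCARÉ INEQUALITY IN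
# PHYSICAL UNITS PLUS THE χ² BUDGET — NOW UNCONDITIONALLY (the hypothesis `hEquiv` of g16 is the theorem
# `generatorPoincare_implies_decay` of g18)

Helper file (seat `ym-line-csu-p1`, g18; `--supports stmt-QuantumFields-24809`).  g16 (`…ChiSquarePoincare`, `…OfChiSquare`) reduced
the crux to (G) a K-uniform STATIC Poincaré inequality `c ε_K Var_{μ_K}(F) ≤ −∫ (F − μ_K F) 𝓛_K f dμ_K` for `C³` cylinder functions
(the form a functional-inequality proof — multiscale Bakry–Émery, Polchinski flow, spectral gap of the Wilson–Gibbs measure — would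
deliver) plus (H2) a K-uniform cold-start χ² budget, MODULO the classical «Poincaré ⇒ `L²` decay» equivalence `hEquiv` at each
fixed cut-off (Bakry–Gentil–Ledoux Thm 4.2.5, whose textbook proof needs a core).  `…WilsonGeneratorPoincare` proves `hEquiv` for
this diffusion (`generatorPoincare_implies_decay`), so:

* ★★ `uniformL2Gap_of_uniformGeneratorPoincare` — (G) ⇒ (H1) of `chiSquareStep` (the K-uniform `L²` gap in physical units),
  UNCONDITIONALLY; with `uniformL2Gap_tfae` (g17) (G) joins the five interchangeable typings of (H1).
* ★★ `UniformColdStartMixing_of_uniformGeneratorPoincare` — (G) + (H2) ⇒ `UniformColdStartMixing` BY NAME, unconditionally.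
* ★ `uniformGeneratorPoincare_of_uniformL2Gap`, ★★ `uniformGeneratorPoincare_iff_uniformL2Gap` — conversely (H1) ⇒ (G) with the
  same constant (`generatorPoincare_of_integral_sq_transition_sub_le_exp`), so (G) ⟺ (H1): a SIXTH interchangeable typing.

THEOREMS ONLY, no definition, no sorry.  HONEST FRAMING: reshaping OPTION for the planner of record (the L² line of LINE 4 may
now START from a static functional inequality for Bałaban's measures `μ_K` with no dynamical hypothesis besides (H2)); (G) and
(H2) are K-UNIFORM statements and OPEN — (G) is the crux in `L²`/Poincaré form; both are theorems at each fixed `K`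
(`wilson_poincare`, `coldChiSquareBudget_fixedCutoff`); nothing K-uniform is proved here; no crux, rung or summit statement is
proved; the Yang–Mills mass gap is NOT proved.
-/

set_option autoImplicit false

noncomputable section

namespace Summit.QuantumFields.YangMills.Theorems.ColdStartUniversality

open MeasureTheory ProbabilityTheory
open scoped NNReal ENNReal
open Literature.Probability.Process Literature.MathematicalPhysics.QuantumFieldTheory
open Literature.MathematicalPhysics.QuantumLattice (fundamentalRep fundamentalLatticeRep continuous_fundamentalRep)
open Literature.MathematicalPhysics.QuantumFieldTheory.Balaban1983to89

/-- ★★ **(H1) from a K-uniform static generator-form Poincaré inequality in physical units — UNCONDITIONALLY.**  If for all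
small `γ` there are `c > 0`, `K₀` with `c ε_K Var_{μ_K}(F) ≤ −∫ (F − μ_K F) 𝓛_K f dμ_K` for every `C³` `f`, `F = f∘coords`, and all
`K ≥ K₀` (`μ_K` = Wilson measure at SZZ coupling `(γε_K)⁻¹/2`, `𝓛_K` the SZZ generator), then the SZZ kernels contract in
`L²(μ_K)` at rate `c ε_K` per unit LATTICE time, i.e. `c` per unit PHYSICAL time, uniformly in `K`: hypothesis (H1) of
`chiSquareStep` verbatim (`uniformL2Gap_of_uniformPoincare` of g16 with `hEquiv := generatorPoincare_implies_decay`).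
[cite: BakryGentilLedoux2014, Thm 4.2.5] -/
theorem uniformL2Gap_of_uniformGeneratorPoincare :
    -- UNIFORM STATIC POINCARÉ INEQUALITY FOR `μ_K` IN PHYSICAL UNITS
    (∃ γ₁ : ℝ, 0 < γ₁ ∧ ∀ (F : T3ContinuumYM3Torus.T3Family) (γ : ℝ), 0 < γ → γ ≤ γ₁ →
      ∃ c : ℝ, 0 < c ∧ ∃ K₀ : ℕ, ∀ K : ℕ, K₀ ≤ K →
        ∀ (f : (Edge 3 ((F.P K).sitesPerDir 0) × Fin 2 × Fin 2 × Bool → ℝ) → ℝ), ContDiff ℝ 3 f →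
        let coords : GaugeConfig 3 ((F.P K).sitesPerDir 0) (Matrix.specialUnitaryGroup (Fin 2) ℂ) →
            (Edge 3 ((F.P K).sitesPerDir 0) × Fin 2 × Fin 2 × Bool → ℝ) :=
          fun V q => (fun z : ℂ => if q.2.2.2 then z.im else z.re)
            ((fundamentalRep (Fin 2) (V q.1) : Matrix (Fin 2) (Fin 2) ℂ) q.2.1 q.2.2.1)
        let gen : GaugeConfig 3 ((F.P K).sitesPerDir 0) (Matrix.specialUnitaryGroup (Fin 2) ℂ) → ℝ := fun V =>
          (∑ i : Edge 3 ((F.P K).sitesPerDir 0) × Fin 2 × Fin 2 × Bool, fderiv ℝ f (coords V) (Pi.single i 1) *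
              (fun z : ℂ => if i.2.2.2 then z.im else z.re)
                ((latticeLangevinDynamics (fundamentalLatticeRep 2) ((γ * (F.P K).eps)⁻¹ / 2)).drift
                  (matrixConfig (fundamentalRep (Fin 2)) V) i.1 i.2.1 i.2.2.1) +
          1 / 2 * ∑ i : Edge 3 ((F.P K).sitesPerDir 0) × Fin 2 × Fin 2 × Bool,
            ∑ j : Edge 3 ((F.P K).sitesPerDir 0) × Fin 2 × Fin 2 × Bool,
            fderiv ℝ (fun z => fderiv ℝ f z (Pi.single i 1)) (coords V) (Pi.single j 1) *
              ∑ n : Edge 3 ((F.P K).sitesPerDir 0) × NoiseIdx 2,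
                (if n.1 = i.1 then (fun z : ℂ => if i.2.2.2 then z.im else z.re)
                  ((latticeLangevinDynamics (fundamentalLatticeRep 2) ((γ * (F.P K).eps)⁻¹ / 2)).noise
                    (matrixConfig (fundamentalRep (Fin 2)) V) i.1 n.2 i.2.1 i.2.2.1) else 0) *
                (if n.1 = j.1 then (fun z : ℂ => if j.2.2.2 then z.im else z.re)
                  ((latticeLangevinDynamics (fundamentalLatticeRep 2) ((γ * (F.P K).eps)⁻¹ / 2)).noise
                    (matrixConfig (fundamentalRep (Fin 2)) V) j.1 n.2 j.2.1 j.2.2.1) else 0))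
        c * (F.P K).eps * ∫ V, (f (coords V) - ∫ V', f (coords V')
            ∂(wilsonMeasure (d := 3) (L := (F.P K).sitesPerDir 0) (fundamentalRep (Fin 2)) ((γ * (F.P K).eps)⁻¹ / 2))) ^ 2
            ∂(wilsonMeasure (d := 3) (L := (F.P K).sitesPerDir 0) (fundamentalRep (Fin 2)) ((γ * (F.P K).eps)⁻¹ / 2)) ≤
          -∫ V, (f (coords V) - ∫ V', f (coords V')
            ∂(wilsonMeasure (d := 3) (L := (F.P K).sitesPerDir 0) (fundamentalRep (Fin 2)) ((γ * (F.P K).eps)⁻¹ / 2))) *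
            gen V ∂(wilsonMeasure (d := 3) (L := (F.P K).sitesPerDir 0) (fundamentalRep (Fin 2)) ((γ * (F.P K).eps)⁻¹ / 2))) →
    -- (H1) of `chiSquareStep`
    (∃ γ₁ : ℝ, 0 < γ₁ ∧ ∀ (F : T3ContinuumYM3Torus.T3Family) (γ : ℝ), 0 < γ → γ ≤ γ₁ →
      ∃ c : ℝ, 0 < c ∧ ∃ K₀ : ℕ, ∀ K : ℕ, K₀ ≤ K →
        ∀ (κ : ℝ≥0 → Kernel (GaugeConfig 3 ((F.P K).sitesPerDir 0) (Matrix.specialUnitaryGroup (Fin 2) ℂ))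
            (GaugeConfig 3 ((F.P K).sitesPerDir 0) (Matrix.specialUnitaryGroup (Fin 2) ℂ))) [∀ t, IsMarkovKernel (κ t)],
          (∀ (t : ℝ≥0) (x : GaugeConfig 3 ((F.P K).sitesPerDir 0) (Matrix.specialUnitaryGroup (Fin 2) ℂ))
            (Ω : Type) [MeasurableSpace Ω] (P : Measure Ω) [IsProbabilityMeasure P]
            (W : ℝ≥0 → Ω → (Edge 3 ((F.P K).sitesPerDir 0) × NoiseIdx 2 → ℝ)) (hW : IsFlatBrownian W P)
            (U : ℝ≥0 → Ω → GaugeConfig 3 ((F.P K).sitesPerDir 0) (Matrix.specialUnitaryGroup (Fin 2) ℂ)),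
            (∀ ω, U 0 ω = x) →
            (latticeLangevinDynamics (fundamentalLatticeRep 2) ((γ * (F.P K).eps)⁻¹ / 2)).IsSolution (fundamentalRep (Fin 2))
              hW.natFiltration P W U →
            κ t x = P.map (U t)) →
          ∀ (G : GaugeConfig 3 ((F.P K).sitesPerDir 0) (Matrix.specialUnitaryGroup (Fin 2) ℂ) → ℝ), Measurable G →
            (∀ x, |G x| ≤ 1) → ∀ t : ℝ≥0,
            ∫ x, ((∫ y, G y ∂(κ t x)) - ∫ z, G z ∂(wilsonMeasure (d := 3) (L := (F.P K).sitesPerDir 0)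
                (fundamentalRep (Fin 2)) ((γ * (F.P K).eps)⁻¹ / 2))) ^ 2
                ∂(wilsonMeasure (d := 3) (L := (F.P K).sitesPerDir 0) (fundamentalRep (Fin 2)) ((γ * (F.P K).eps)⁻¹ / 2)) ≤
              Real.exp (-2 * c * ((F.P K).eps * t)) *
                ∫ x, (G x - ∫ z, G z ∂(wilsonMeasure (d := 3) (L := (F.P K).sitesPerDir 0)
                  (fundamentalRep (Fin 2)) ((γ * (F.P K).eps)⁻¹ / 2))) ^ 2
                  ∂(wilsonMeasure (d := 3) (L := (F.P K).sitesPerDir 0) (fundamentalRep (Fin 2)) ((γ * (F.P K).eps)⁻¹ / 2))) :=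
  uniformL2Gap_of_uniformPoincare generatorPoincare_implies_decay

/-- ★★ **THE CRUX `UniformColdStartMixing` (24809; hence `NeutralColdStartMixing` 27363 via `neutral_of_uniform`) from (G) a K-uniform
static generator-form Poincaré inequality in physical units and (H2) a K-uniform cold-start χ² budget — UNCONDITIONALLY**
(`UniformColdStartMixing_of_uniformPoincare` of g16 with `hEquiv := generatorPoincare_implies_decay`; chain: (G) ⇒ (H1)
[`generatorPoincare_implies_decay` at each cut-off] ⇒ with (H2) `PointwiseMixing` [`chiSquareStep`] ⇒ the crux [`cesaroStep`]).
Both hypotheses are K-UNIFORM and OPEN; nothing K-uniform is proved here. [cite: BakryGentilLedoux2014, Thm 4.2.5] -/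
theorem UniformColdStartMixing_of_uniformGeneratorPoincare :
    (∃ γ₁ : ℝ, 0 < γ₁ ∧ ∀ (F : T3ContinuumYM3Torus.T3Family) (γ : ℝ), 0 < γ → γ ≤ γ₁ →
      ∃ c : ℝ, 0 < c ∧ ∃ K₀ : ℕ, ∀ K : ℕ, K₀ ≤ K →
        ∀ (f : (Edge 3 ((F.P K).sitesPerDir 0) × Fin 2 × Fin 2 × Bool → ℝ) → ℝ), ContDiff ℝ 3 f →
        let coords : GaugeConfig 3 ((F.P K).sitesPerDir 0) (Matrix.specialUnitaryGroup (Fin 2) ℂ) →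
            (Edge 3 ((F.P K).sitesPerDir 0) × Fin 2 × Fin 2 × Bool → ℝ) :=
          fun V q => (fun z : ℂ => if q.2.2.2 then z.im else z.re)
            ((fundamentalRep (Fin 2) (V q.1) : Matrix (Fin 2) (Fin 2) ℂ) q.2.1 q.2.2.1)
        let gen : GaugeConfig 3 ((F.P K).sitesPerDir 0) (Matrix.specialUnitaryGroup (Fin 2) ℂ) → ℝ := fun V =>
          (∑ i : Edge 3 ((F.P K).sitesPerDir 0) × Fin 2 × Fin 2 × Bool, fderiv ℝ f (coords V) (Pi.single i 1) *
              (fun z : ℂ => if i.2.2.2 then z.im else z.re)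
                ((latticeLangevinDynamics (fundamentalLatticeRep 2) ((γ * (F.P K).eps)⁻¹ / 2)).drift
                  (matrixConfig (fundamentalRep (Fin 2)) V) i.1 i.2.1 i.2.2.1) +
          1 / 2 * ∑ i : Edge 3 ((F.P K).sitesPerDir 0) × Fin 2 × Fin 2 × Bool,
            ∑ j : Edge 3 ((F.P K).sitesPerDir 0) × Fin 2 × Fin 2 × Bool,
            fderiv ℝ (fun z => fderiv ℝ f z (Pi.single i 1)) (coords V) (Pi.single j 1) *
              ∑ n : Edge 3 ((F.P K).sitesPerDir 0) × NoiseIdx 2,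
                (if n.1 = i.1 then (fun z : ℂ => if i.2.2.2 then z.im else z.re)
                  ((latticeLangevinDynamics (fundamentalLatticeRep 2) ((γ * (F.P K).eps)⁻¹ / 2)).noise
                    (matrixConfig (fundamentalRep (Fin 2)) V) i.1 n.2 i.2.1 i.2.2.1) else 0) *
                (if n.1 = j.1 then (fun z : ℂ => if j.2.2.2 then z.im else z.re)
                  ((latticeLangevinDynamics (fundamentalLatticeRep 2) ((γ * (F.P K).eps)⁻¹ / 2)).noise
                    (matrixConfig (fundamentalRep (Fin 2)) V) j.1 n.2 j.2.1 j.2.2.1) else 0))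
        c * (F.P K).eps * ∫ V, (f (coords V) - ∫ V', f (coords V')
            ∂(wilsonMeasure (d := 3) (L := (F.P K).sitesPerDir 0) (fundamentalRep (Fin 2)) ((γ * (F.P K).eps)⁻¹ / 2))) ^ 2
            ∂(wilsonMeasure (d := 3) (L := (F.P K).sitesPerDir 0) (fundamentalRep (Fin 2)) ((γ * (F.P K).eps)⁻¹ / 2)) ≤
          -∫ V, (f (coords V) - ∫ V', f (coords V')
            ∂(wilsonMeasure (d := 3) (L := (F.P K).sitesPerDir 0) (fundamentalRep (Fin 2)) ((γ * (F.P K).eps)⁻¹ / 2))) *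
            gen V ∂(wilsonMeasure (d := 3) (L := (F.P K).sitesPerDir 0) (fundamentalRep (Fin 2)) ((γ * (F.P K).eps)⁻¹ / 2))) →
    (∃ γ₁ : ℝ, 0 < γ₁ ∧ ∀ (F : T3ContinuumYM3Torus.T3Family) (γ : ℝ), 0 < γ → γ ≤ γ₁ →
      ∃ s₀ X₀ : ℝ, 0 < s₀ ∧ 0 ≤ X₀ ∧ ∃ K₀ : ℕ, ∀ K : ℕ, K₀ ≤ K →
        ∀ (Ω : Type) (mΩ : MeasurableSpace Ω) (P : Measure Ω) (_ : IsProbabilityMeasure P)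
          (W : ℝ≥0 → Ω → (Edge 3 ((F.P K).sitesPerDir 0) × NoiseIdx 2 → ℝ)) (hW : IsFlatBrownian W P)
          (U : ℝ≥0 → Ω → GaugeConfig 3 ((F.P K).sitesPerDir 0) (Matrix.specialUnitaryGroup (Fin 2) ℂ)),
          ((∀ ω, U 0 ω = fun _ => 1) ∧
            (latticeLangevinDynamics (⟨2, fundamentalRep (Fin 2), continuous_fundamentalRep _,
                Literature.MathematicalPhysics.QuantumLattice.fundamentalRep_injective _,
                Literature.MathematicalPhysics.QuantumLattice.fundamentalRep_mem_unitaryGroup⟩ :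
                LatticeRep (Matrix.specialUnitaryGroup (Fin 2) ℂ)) ((γ * (F.P K).eps)⁻¹ / 2)).IsSolution
              (fundamentalRep (Fin 2)) hW.natFiltration P W U) →
          ∀ (G : GaugeConfig 3 ((F.P K).sitesPerDir 0) (Matrix.specialUnitaryGroup (Fin 2) ℂ) → ℝ), Measurable G →
            (∀ x, |G x| ≤ 1) →
            ((∫ ω, G (U (s₀ / (F.P K).eps).toNNReal ω) ∂P) - ∫ z, G z ∂(wilsonMeasure (d := 3) (L := (F.P K).sitesPerDir 0)
                (fundamentalRep (Fin 2)) ((γ * (F.P K).eps)⁻¹ / 2))) ^ 2 ≤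
              X₀ * ∫ x, (G x - ∫ z, G z ∂(wilsonMeasure (d := 3) (L := (F.P K).sitesPerDir 0)
                (fundamentalRep (Fin 2)) ((γ * (F.P K).eps)⁻¹ / 2))) ^ 2
                ∂(wilsonMeasure (d := 3) (L := (F.P K).sitesPerDir 0) (fundamentalRep (Fin 2)) ((γ * (F.P K).eps)⁻¹ / 2))) →
    Summit.QuantumFields.YangMills.Theses.ColdStartUniversality.UniformColdStartMixing :=
  UniformColdStartMixing_of_uniformPoincare generatorPoincare_implies_decay

/-- ★ **Conversely, (H1) ⇒ (G) with the same constant**: a K-uniform `L²` gap in physical units gives the K-uniform static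
generator-form Poincaré inequality (at each cut-off: the bounded-measurable decay of (H1) passes to continuous observables by
`integral_sq_transition_sub_le_exp_continuous_of_bounded`, then `generatorPoincare_of_integral_sq_transition_sub_le_exp` on THE
transition kernels `exists_transitionKernel`). [cite: BakryGentilLedoux2014, Thm 4.2.5] -/
theorem uniformGeneratorPoincare_of_uniformL2Gap :
    (∃ γ₁ : ℝ, 0 < γ₁ ∧ ∀ (F : T3ContinuumYM3Torus.T3Family) (γ : ℝ), 0 < γ → γ ≤ γ₁ →
      ∃ c : ℝ, 0 < c ∧ ∃ K₀ : ℕ, ∀ K : ℕ, K₀ ≤ K →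
        ∀ (κ : ℝ≥0 → Kernel (GaugeConfig 3 ((F.P K).sitesPerDir 0) (Matrix.specialUnitaryGroup (Fin 2) ℂ))
            (GaugeConfig 3 ((F.P K).sitesPerDir 0) (Matrix.specialUnitaryGroup (Fin 2) ℂ))) [∀ t, IsMarkovKernel (κ t)],
          (∀ (t : ℝ≥0) (x : GaugeConfig 3 ((F.P K).sitesPerDir 0) (Matrix.specialUnitaryGroup (Fin 2) ℂ))
            (Ω : Type) [MeasurableSpace Ω] (P : Measure Ω) [IsProbabilityMeasure P]
            (W : ℝ≥0 → Ω → (Edge 3 ((F.P K).sitesPerDir 0) × NoiseIdx 2 → ℝ)) (hW : IsFlatBrownian W P)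
            (U : ℝ≥0 → Ω → GaugeConfig 3 ((F.P K).sitesPerDir 0) (Matrix.specialUnitaryGroup (Fin 2) ℂ)),
            (∀ ω, U 0 ω = x) →
            (latticeLangevinDynamics (fundamentalLatticeRep 2) ((γ * (F.P K).eps)⁻¹ / 2)).IsSolution (fundamentalRep (Fin 2))
              hW.natFiltration P W U →
            κ t x = P.map (U t)) →
          ∀ (G : GaugeConfig 3 ((F.P K).sitesPerDir 0) (Matrix.specialUnitaryGroup (Fin 2) ℂ) → ℝ), Measurable G →
            (∀ x, |G x| ≤ 1) → ∀ t : ℝ≥0,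
            ∫ x, ((∫ y, G y ∂(κ t x)) - ∫ z, G z ∂(wilsonMeasure (d := 3) (L := (F.P K).sitesPerDir 0)
                (fundamentalRep (Fin 2)) ((γ * (F.P K).eps)⁻¹ / 2))) ^ 2
                ∂(wilsonMeasure (d := 3) (L := (F.P K).sitesPerDir 0) (fundamentalRep (Fin 2)) ((γ * (F.P K).eps)⁻¹ / 2)) ≤
              Real.exp (-2 * c * ((F.P K).eps * t)) *
                ∫ x, (G x - ∫ z, G z ∂(wilsonMeasure (d := 3) (L := (F.P K).sitesPerDir 0)
                  (fundamentalRep (Fin 2)) ((γ * (F.P K).eps)⁻¹ / 2))) ^ 2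
                  ∂(wilsonMeasure (d := 3) (L := (F.P K).sitesPerDir 0) (fundamentalRep (Fin 2)) ((γ * (F.P K).eps)⁻¹ / 2))) →
    (∃ γ₁ : ℝ, 0 < γ₁ ∧ ∀ (F : T3ContinuumYM3Torus.T3Family) (γ : ℝ), 0 < γ → γ ≤ γ₁ →
      ∃ c : ℝ, 0 < c ∧ ∃ K₀ : ℕ, ∀ K : ℕ, K₀ ≤ K →
        ∀ (f : (Edge 3 ((F.P K).sitesPerDir 0) × Fin 2 × Fin 2 × Bool → ℝ) → ℝ), ContDiff ℝ 3 f →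
        let coords : GaugeConfig 3 ((F.P K).sitesPerDir 0) (Matrix.specialUnitaryGroup (Fin 2) ℂ) →
            (Edge 3 ((F.P K).sitesPerDir 0) × Fin 2 × Fin 2 × Bool → ℝ) :=
          fun V q => (fun z : ℂ => if q.2.2.2 then z.im else z.re)
            ((fundamentalRep (Fin 2) (V q.1) : Matrix (Fin 2) (Fin 2) ℂ) q.2.1 q.2.2.1)
        let gen : GaugeConfig 3 ((F.P K).sitesPerDir 0) (Matrix.specialUnitaryGroup (Fin 2) ℂ) → ℝ := fun V =>
          (∑ i : Edge 3 ((F.P K).sitesPerDir 0) × Fin 2 × Fin 2 × Bool, fderiv ℝ f (coords V) (Pi.single i 1) *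
              (fun z : ℂ => if i.2.2.2 then z.im else z.re)
                ((latticeLangevinDynamics (fundamentalLatticeRep 2) ((γ * (F.P K).eps)⁻¹ / 2)).drift
                  (matrixConfig (fundamentalRep (Fin 2)) V) i.1 i.2.1 i.2.2.1) +
          1 / 2 * ∑ i : Edge 3 ((F.P K).sitesPerDir 0) × Fin 2 × Fin 2 × Bool,
            ∑ j : Edge 3 ((F.P K).sitesPerDir 0) × Fin 2 × Fin 2 × Bool,
            fderiv ℝ (fun z => fderiv ℝ f z (Pi.single i 1)) (coords V) (Pi.single j 1) *
              ∑ n : Edge 3 ((F.P K).sitesPerDir 0) × NoiseIdx 2,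
                (if n.1 = i.1 then (fun z : ℂ => if i.2.2.2 then z.im else z.re)
                  ((latticeLangevinDynamics (fundamentalLatticeRep 2) ((γ * (F.P K).eps)⁻¹ / 2)).noise
                    (matrixConfig (fundamentalRep (Fin 2)) V) i.1 n.2 i.2.1 i.2.2.1) else 0) *
                (if n.1 = j.1 then (fun z : ℂ => if j.2.2.2 then z.im else z.re)
                  ((latticeLangevinDynamics (fundamentalLatticeRep 2) ((γ * (F.P K).eps)⁻¹ / 2)).noise
                    (matrixConfig (fundamentalRep (Fin 2)) V) j.1 n.2 j.2.1 j.2.2.1) else 0))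
        c * (F.P K).eps * ∫ V, (f (coords V) - ∫ V', f (coords V')
            ∂(wilsonMeasure (d := 3) (L := (F.P K).sitesPerDir 0) (fundamentalRep (Fin 2)) ((γ * (F.P K).eps)⁻¹ / 2))) ^ 2
            ∂(wilsonMeasure (d := 3) (L := (F.P K).sitesPerDir 0) (fundamentalRep (Fin 2)) ((γ * (F.P K).eps)⁻¹ / 2)) ≤
          -∫ V, (f (coords V) - ∫ V', f (coords V')
            ∂(wilsonMeasure (d := 3) (L := (F.P K).sitesPerDir 0) (fundamentalRep (Fin 2)) ((γ * (F.P K).eps)⁻¹ / 2))) *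
            gen V ∂(wilsonMeasure (d := 3) (L := (F.P K).sitesPerDir 0) (fundamentalRep (Fin 2)) ((γ * (F.P K).eps)⁻¹ / 2))) := by
  rintro ⟨γ₁, hγ₁, h⟩
  refine ⟨γ₁, hγ₁, fun F γ hγ hγle => ?_⟩
  obtain ⟨c, hc, K₀, hK⟩ := h F γ hγ hγle
  refine ⟨c, hc, K₀, fun K hKK f hf => ?_⟩
  obtain ⟨κ, hκM, -, hreal⟩ := exists_transitionKernel ((F.P K).sitesPerDir 0) ((γ * (F.P K).eps)⁻¹ / 2)
  haveI := hκM
  have hdec : ∀ (G : GaugeConfig 3 ((F.P K).sitesPerDir 0) (Matrix.specialUnitaryGroup (Fin 2) ℂ) → ℝ), Continuous G →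
      ∀ t : ℝ≥0,
      ∫ x, ((∫ y, G y ∂(κ t x)) - ∫ z, G z ∂(wilsonMeasure (d := 3) (L := (F.P K).sitesPerDir 0)
          (fundamentalRep (Fin 2)) ((γ * (F.P K).eps)⁻¹ / 2))) ^ 2
          ∂(wilsonMeasure (d := 3) (L := (F.P K).sitesPerDir 0) (fundamentalRep (Fin 2)) ((γ * (F.P K).eps)⁻¹ / 2)) ≤
        Real.exp (-2 * (c * (F.P K).eps) * t) *
          ∫ x, (G x - ∫ z, G z ∂(wilsonMeasure (d := 3) (L := (F.P K).sitesPerDir 0)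
            (fundamentalRep (Fin 2)) ((γ * (F.P K).eps)⁻¹ / 2))) ^ 2
            ∂(wilsonMeasure (d := 3) (L := (F.P K).sitesPerDir 0) (fundamentalRep (Fin 2)) ((γ * (F.P K).eps)⁻¹ / 2)) := by
    intro G hG t
    have h1 := integral_sq_transition_sub_le_exp_continuous_of_bounded ((F.P K).sitesPerDir 0) ((γ * (F.P K).eps)⁻¹ / 2) κ
      (r := Real.exp (-2 * c * ((F.P K).eps * t))) (t := t) (fun G' hG' hb => hK K hKK κ hreal G' hG' hb t) hG
    have e : -2 * c * ((F.P K).eps * (t : ℝ)) = -2 * (c * (F.P K).eps) * t := by ring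
    rwa [e] at h1
  exact generatorPoincare_of_integral_sq_transition_sub_le_exp ((F.P K).sitesPerDir 0) ((γ * (F.P K).eps)⁻¹ / 2) κ hreal
    hdec f hf

/-- ★★ **(G) ⟺ (H1)**: the K-uniform static generator-form Poincaré inequality in physical units and the K-uniform `L²` gap of the
SZZ dynamics in physical units are EQUIVALENT, with the same constant — a sixth member of `uniformL2Gap_tfae` (g17).
Both sides are OPEN (the crux in `L²` form). [cite: BakryGentilLedoux2014, Thm 4.2.5] -/
theorem uniformGeneratorPoincare_iff_uniformL2Gap :
    (∃ γ₁ : ℝ, 0 < γ₁ ∧ ∀ (F : T3ContinuumYM3Torus.T3Family) (γ : ℝ), 0 < γ → γ ≤ γ₁ →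
      ∃ c : ℝ, 0 < c ∧ ∃ K₀ : ℕ, ∀ K : ℕ, K₀ ≤ K →
        ∀ (f : (Edge 3 ((F.P K).sitesPerDir 0) × Fin 2 × Fin 2 × Bool → ℝ) → ℝ), ContDiff ℝ 3 f →
        let coords : GaugeConfig 3 ((F.P K).sitesPerDir 0) (Matrix.specialUnitaryGroup (Fin 2) ℂ) →
            (Edge 3 ((F.P K).sitesPerDir 0) × Fin 2 × Fin 2 × Bool → ℝ) :=
          fun V q => (fun z : ℂ => if q.2.2.2 then z.im else z.re)
            ((fundamentalRep (Fin 2) (V q.1) : Matrix (Fin 2) (Fin 2) ℂ) q.2.1 q.2.2.1)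
        let gen : GaugeConfig 3 ((F.P K).sitesPerDir 0) (Matrix.specialUnitaryGroup (Fin 2) ℂ) → ℝ := fun V =>
          (∑ i : Edge 3 ((F.P K).sitesPerDir 0) × Fin 2 × Fin 2 × Bool, fderiv ℝ f (coords V) (Pi.single i 1) *
              (fun z : ℂ => if i.2.2.2 then z.im else z.re)
                ((latticeLangevinDynamics (fundamentalLatticeRep 2) ((γ * (F.P K).eps)⁻¹ / 2)).drift
                  (matrixConfig (fundamentalRep (Fin 2)) V) i.1 i.2.1 i.2.2.1) +
          1 / 2 * ∑ i : Edge 3 ((F.P K).sitesPerDir 0) × Fin 2 × Fin 2 × Bool,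
            ∑ j : Edge 3 ((F.P K).sitesPerDir 0) × Fin 2 × Fin 2 × Bool,
            fderiv ℝ (fun z => fderiv ℝ f z (Pi.single i 1)) (coords V) (Pi.single j 1) *
              ∑ n : Edge 3 ((F.P K).sitesPerDir 0) × NoiseIdx 2,
                (if n.1 = i.1 then (fun z : ℂ => if i.2.2.2 then z.im else z.re)
                  ((latticeLangevinDynamics (fundamentalLatticeRep 2) ((γ * (F.P K).eps)⁻¹ / 2)).noise
                    (matrixConfig (fundamentalRep (Fin 2)) V) i.1 n.2 i.2.1 i.2.2.1) else 0) *
                (if n.1 = j.1 then (fun z : ℂ => if j.2.2.2 then z.im else z.re)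
                  ((latticeLangevinDynamics (fundamentalLatticeRep 2) ((γ * (F.P K).eps)⁻¹ / 2)).noise
                    (matrixConfig (fundamentalRep (Fin 2)) V) j.1 n.2 j.2.1 j.2.2.1) else 0))
        c * (F.P K).eps * ∫ V, (f (coords V) - ∫ V', f (coords V')
            ∂(wilsonMeasure (d := 3) (L := (F.P K).sitesPerDir 0) (fundamentalRep (Fin 2)) ((γ * (F.P K).eps)⁻¹ / 2))) ^ 2
            ∂(wilsonMeasure (d := 3) (L := (F.P K).sitesPerDir 0) (fundamentalRep (Fin 2)) ((γ * (F.P K).eps)⁻¹ / 2)) ≤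
          -∫ V, (f (coords V) - ∫ V', f (coords V')
            ∂(wilsonMeasure (d := 3) (L := (F.P K).sitesPerDir 0) (fundamentalRep (Fin 2)) ((γ * (F.P K).eps)⁻¹ / 2))) *
            gen V ∂(wilsonMeasure (d := 3) (L := (F.P K).sitesPerDir 0) (fundamentalRep (Fin 2)) ((γ * (F.P K).eps)⁻¹ / 2))) ↔
    (∃ γ₁ : ℝ, 0 < γ₁ ∧ ∀ (F : T3ContinuumYM3Torus.T3Family) (γ : ℝ), 0 < γ → γ ≤ γ₁ →
      ∃ c : ℝ, 0 < c ∧ ∃ K₀ : ℕ, ∀ K : ℕ, K₀ ≤ K →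
        ∀ (κ : ℝ≥0 → Kernel (GaugeConfig 3 ((F.P K).sitesPerDir 0) (Matrix.specialUnitaryGroup (Fin 2) ℂ))
            (GaugeConfig 3 ((F.P K).sitesPerDir 0) (Matrix.specialUnitaryGroup (Fin 2) ℂ))) [∀ t, IsMarkovKernel (κ t)],
          (∀ (t : ℝ≥0) (x : GaugeConfig 3 ((F.P K).sitesPerDir 0) (Matrix.specialUnitaryGroup (Fin 2) ℂ))
            (Ω : Type) [MeasurableSpace Ω] (P : Measure Ω) [IsProbabilityMeasure P]
            (W : ℝ≥0 → Ω → (Edge 3 ((F.P K).sitesPerDir 0) × NoiseIdx 2 → ℝ)) (hW : IsFlatBrownian W P)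
            (U : ℝ≥0 → Ω → GaugeConfig 3 ((F.P K).sitesPerDir 0) (Matrix.specialUnitaryGroup (Fin 2) ℂ)),
            (∀ ω, U 0 ω = x) →
            (latticeLangevinDynamics (fundamentalLatticeRep 2) ((γ * (F.P K).eps)⁻¹ / 2)).IsSolution (fundamentalRep (Fin 2))
              hW.natFiltration P W U →
            κ t x = P.map (U t)) →
          ∀ (G : GaugeConfig 3 ((F.P K).sitesPerDir 0) (Matrix.specialUnitaryGroup (Fin 2) ℂ) → ℝ), Measurable G →
            (∀ x, |G x| ≤ 1) → ∀ t : ℝ≥0,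
            ∫ x, ((∫ y, G y ∂(κ t x)) - ∫ z, G z ∂(wilsonMeasure (d := 3) (L := (F.P K).sitesPerDir 0)
                (fundamentalRep (Fin 2)) ((γ * (F.P K).eps)⁻¹ / 2))) ^ 2
                ∂(wilsonMeasure (d := 3) (L := (F.P K).sitesPerDir 0) (fundamentalRep (Fin 2)) ((γ * (F.P K).eps)⁻¹ / 2)) ≤
              Real.exp (-2 * c * ((F.P K).eps * t)) *
                ∫ x, (G x - ∫ z, G z ∂(wilsonMeasure (d := 3) (L := (F.P K).sitesPerDir 0)
                  (fundamentalRep (Fin 2)) ((γ * (F.P K).eps)⁻¹ / 2))) ^ 2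
                  ∂(wilsonMeasure (d := 3) (L := (F.P K).sitesPerDir 0) (fundamentalRep (Fin 2)) ((γ * (F.P K).eps)⁻¹ / 2))) :=
  ⟨uniformL2Gap_of_uniformGeneratorPoincare, uniformGeneratorPoincare_of_uniformL2Gap⟩

end Summit.QuantumFields.YangMills.Theorems.ColdStartUniversality

end
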